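import Literature.MathematicalPhysics.QuantumLattice.GrassmannIntegral
import Literature.MathematicalPhysics.QuantumLattice.GaugeGroups
import Literature.MeasureTheory.Lebesgue.TrigonometricPolynomialZeroSet
import Mathlib.LinearAlgebra.Matrix.Permutation
import Mathlib.LinearAlgebra.Matrix.Block
import Mathlib.MeasureTheory.Group.Measure
import HarnessLib

/-!
# The massless staggered Dirac operator is invertible for Haar-almost every gauge field

Salmhofer–Seiler, Commun. Math. Phys. **139** (1991) 395–432, §2: `U(N)` lattice gauge theory with
one-component staggered fermions on the torus `Λ = (ℤ/Lℤ)^ν` at `β = 0`.  The fermionic weight is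
the Berezin integral of `e^{-S_F(U)} = e^{ψ̄(-D[U])ψ}` ((2.3), (2.9)–(2.11)), `D[U]` the staggered
(Kogut–Susskind) Dirac operator — the tree's
`Literature.MathematicalPhysics.QuantumLattice.staggeredDirac` (module `GrassmannIntegral`) in the
defining representation `unitaryFundamentalRep` of `U(N)`.  At zero mass `D₀[U]` is singular for
some gauge fields (e.g. `U = 1` with periodic boundary conditions: the zero momentum mode), and the
"Wick" form of fermionic expectations, written with the propagator `D₀[U]⁻¹` (as in the typed
conjecture `Summit.Ventures.YMGap.Conjectures.SalmhoferSeilerSmallBeta`, whose docstring asserts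
that the singular set is Haar-null), agrees with the Berezin form only off the singular set.  This
file proves that the singular set IS null:

* **`measure_pi_setOf_det_staggeredDirac_eq_zero`** — for `ν ≥ 1`, every `L ≥ 1`, `N`, the set
  `{U : det D₀[U] = 0}` has measure zero for the product Haar probability measure `∏_b dU_b` on
  `U(N)^{edges}` (the `β = 0` Wilson weight); a.e. form `ae_det_staggeredDirac_ne_zero`.

Proof (not in print; a substitute for "the zero set of a real-analytic function `≢ 0` on a connected
compact Lie group is Haar-null", which the tree cannot carry).  (1) RANDOM CENTRAL REPHASING: for
angles `θ : edges → ℝ` put `(θ • U)_b = e^{iθ_b} U_b` (`rephase`); for each fixed `θ` this is left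
multiplication by fixed group elements, so it preserves `∏ dU_b` (`measurePreserving_rephase`), and
by Tonelli `μ(Z) = ∫ dU · vol{θ ∈ [0,1]^{edges} : e^{iθ}U ∈ Z}` (`linkHaar_eq_zero_of_rephase`).
(2) For EVERY `U`, `θ ↦ det D₀[e^{iθ} U]` is, up to the unit factor `∏_{rows} s_x(e^{iθ})`, the
torus evaluation of a polynomial `R_U ∈ ℂ[z_b : b an edge]` (`detPoly`): multiplying row `(x, a)` of
`D₀[zU]` by `s_x = ∏_{μ} z_{(x - e_μ, μ)}` (the variables of the links arriving at `x`) turns the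
forward entries `½η z_{(x,μ)} U` into the monomials `s_x z_{(x,μ)}` and the backward entries
`-½η z_{(x-e_μ,μ)}⁻¹ U⁻¹` into the monomials `∏_{μ' ≠ μ} z_{(x-e_{μ'},μ')}` (`eval_torusPt_detPoly`).
(3) `R_U ≠ 0` (`detPoly_ne_zero`): at the complex point `z_b = t` on the links of direction `0` and
`z_b = 1` elsewhere, the scaled matrix is `t²(F₀ + t⁻¹M + t⁻²B₀)` with `F₀ =` the forward hops in
direction `0`, a block permutation matrix with `det F₀ = ± 2^{-n} ∏_x det U_{(x,0)} ≠ 0`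
(`det_forwardHop_ne_zero`); by continuity of `det` the scaled determinant is nonzero for large `t`.
(4) The zero set of a nonzero polynomial on the torus is Lebesgue-null
(`MvPolynomial.volume_torusZeroSet_eq_zero_of_fintype`, file
`Literature/MeasureTheory/Lebesgue/TrigonometricPolynomialZeroSet.lean`).

Scope: `G = U(N)` with its defining representation (the rephasing uses the central circle
`e^{iθ} 1 ∈ U(N)`); any `ν ≥ 1`, `L ≥ 1` (`[NeZero L]`), `N`; periodic links `(x, x + e_μ)` and the
phases `η_μ(x)` exactly as in the tree's `staggeredDirac` (their values play no role).  Nothing about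
`β > 0`, `SU(N)`, the continuum, or a mass gap.  No facts, no `sorry`.

## References

* M. Salmhofer, E. Seiler, Commun. Math. Phys. 139 (1991) 395–432, §2 (2.3), (2.9)–(2.11)
  [SalmhoferSeiler1991].
* R. Caron, T. Traynor, *The zero set of a polynomial* (2005) [CaronTraynor2005] (step (4)).
-/

noncomputable section

open MeasureTheory Matrix Complex Finset
open Literature.MathematicalPhysics.QuantumFieldTheory
open Literature.Probability.LatticeModels (TorusSite)
open scoped ComplexConjugate BigOperators

namespace Literature.MathematicalPhysics.QuantumLattice

namespace StaggeredSingular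

variable {ν L N : ℕ} [NeZero L]

/-- Colour indices `(x, a)`, `x ∈ Λ`, `a ∈ {1,…,N}` — the index type of `staggeredDirac`. [cite: SalmhoferSeiler1991, §2 (2.3)] -/
abbrev CI (ν L N : ℕ) : Type := TorusSite ν L × Fin N

/-- The unit lattice vector `e_μ`. [cite: SalmhoferSeiler1991, §2 (2.1)] -/
abbrev unitVec (μ : Fin ν) : TorusSite ν L := Pi.single μ 1

/-! ## 1. The generic hopping shape of the massless staggered operator -/

section Shape

variable {R : Type*} [CommRing R] [Algebra ℂ R]

/-- The common shape of all matrices in this file: row `(x,a)`, column `(y,b)`,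
`½ ∑_μ η_μ(x) ( [y = x + e_μ] a(x,μ) V(x,μ)_{ab} − [x = y + e_μ] b(x,μ) W(y,μ)_{ab} )` with scalar row
weights `a, b` and link matrices `V, W`.  For `a = b = 1`, `V = U`, `W = U⁻¹` this is `D₀[U]`
(`D0_eq_hopShape`). [cite: SalmhoferSeiler1991, §2 (2.3)] -/
def hopShape (a b : TorusSite ν L → Fin ν → R) (V W : TorusSite ν L × Fin ν → Matrix (Fin N) (Fin N) R) :
    Matrix (CI ν L N) (CI ν L N) R :=
  Matrix.of fun p q => ((1 / 2 : ℂ)) • ∑ μ : Fin ν, ((staggeredPhase p.1 μ : ℤ) : ℂ) •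
    ((if q.1 = p.1 + unitVec μ then a p.1 μ * V (p.1, μ) p.2 q.2 else 0) -
      (if p.1 = q.1 + unitVec μ then b p.1 μ * W (q.1, μ) p.2 q.2 else 0))

omit [NeZero L] in
/-- Entry formula of `hopShape`. [cite: SalmhoferSeiler1991, §2 (2.3)] -/
theorem hopShape_apply (a b : TorusSite ν L → Fin ν → R) (V W : TorusSite ν L × Fin ν → Matrix (Fin N) (Fin N) R)
    (p q : CI ν L N) :
    hopShape a b V W p q = ((1 / 2 : ℂ)) • ∑ μ : Fin ν, ((staggeredPhase p.1 μ : ℤ) : ℂ) •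
      ((if q.1 = p.1 + unitVec μ then a p.1 μ * V (p.1, μ) p.2 q.2 else 0) -
        (if p.1 = q.1 + unitVec μ then b p.1 μ * W (q.1, μ) p.2 q.2 else 0)) := rfl

/-- Scaling the row weights scales `hopShape` by the corresponding diagonal matrix (row `(x,a)` by `c x`). [cite: SalmhoferSeiler1991, §2 (2.3)] -/
theorem diagonal_mul_hopShape (c : TorusSite ν L → R) (a b : TorusSite ν L → Fin ν → R)
    (V W : TorusSite ν L × Fin ν → Matrix (Fin N) (Fin N) R) :
    Matrix.diagonal (fun p : CI ν L N => c p.1) * hopShape a b V W =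
      hopShape (fun x μ => c x * a x μ) (fun x μ => c x * b x μ) V W := by
  ext p q
  rw [Matrix.diagonal_mul, hopShape_apply, hopShape_apply, mul_smul_comm, Finset.mul_sum]
  congr 1
  refine Finset.sum_congr rfl fun μ _ => ?_
  rw [mul_smul_comm]
  congr 1
  split_ifs <;> ring

/-- A scalar multiple of `hopShape` is `hopShape` with scaled row weights. [cite: SalmhoferSeiler1991, §2 (2.3)] -/
theorem smul_hopShape (r : R) (a b : TorusSite ν L → Fin ν → R)
    (V W : TorusSite ν L × Fin ν → Matrix (Fin N) (Fin N) R) :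
    r • hopShape a b V W = hopShape (fun x μ => r * a x μ) (fun x μ => r * b x μ) V W := by
  have h := diagonal_mul_hopShape (fun _ => r) a b V W
  rw [← h]
  ext p q
  rw [Matrix.smul_apply, Matrix.diagonal_mul, smul_eq_mul]

omit [NeZero L] in
/-- Scalar factors on the link matrices move into the row weights (the backward link at row `x` in
direction `μ` is `(x - e_μ, μ)`). [cite: SalmhoferSeiler1991, §2 (2.3)] -/
theorem hopShape_smul_links (a b : TorusSite ν L → Fin ν → R) (c d : TorusSite ν L × Fin ν → R)
    (V W : TorusSite ν L × Fin ν → Matrix (Fin N) (Fin N) R) :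
    hopShape a b (fun e => c e • V e) (fun e => d e • W e) =
      hopShape (fun x μ => a x μ * c (x, μ)) (fun x μ => b x μ * d (x - unitVec μ, μ)) V W := by
  ext p q
  rw [hopShape_apply, hopShape_apply]
  congr 1
  refine Finset.sum_congr rfl fun μ _ => ?_
  congr 1
  congr 1
  · split_ifs
    · rw [Matrix.smul_apply, smul_eq_mul, mul_assoc]
    · rfl
  · split_ifs with h
    · rw [Matrix.smul_apply, smul_eq_mul, h, add_sub_cancel_right, mul_assoc]
    · rfl

/-- Ring-homomorphic images of `hopShape` (used with `MvPolynomial.aeval`). [cite: SalmhoferSeiler1991, §2 (2.3)] -/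
theorem algHom_mapMatrix_hopShape {S : Type*} [CommRing S] [Algebra ℂ S] (f : R →ₐ[ℂ] S)
    (a b : TorusSite ν L → Fin ν → R) (V W : TorusSite ν L × Fin ν → Matrix (Fin N) (Fin N) R) :
    f.mapMatrix (hopShape a b V W) =
      hopShape (fun x μ => f (a x μ)) (fun x μ => f (b x μ)) (fun e => f.mapMatrix (V e)) (fun e => f.mapMatrix (W e)) := by
  ext p q
  rw [AlgHom.mapMatrix_apply, Matrix.map_apply, hopShape_apply, hopShape_apply, map_smul, map_sum]
  congr 1
  refine Finset.sum_congr rfl fun μ _ => ?_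
  rw [map_smul, map_sub]
  congr 1
  congr 1
  · split_ifs
    · rw [map_mul, AlgHom.mapMatrix_apply, Matrix.map_apply]
    · rw [map_zero]
  · split_ifs
    · rw [map_mul, AlgHom.mapMatrix_apply, Matrix.map_apply]
    · rw [map_zero]

end Shape

/-! ## 2. `D₀[U]` and its central rephasings -/

section Dirac

/-- `U(N)`. [cite: SalmhoferSeiler1991, §2 (2.2)] -/
abbrev UN (N : ℕ) : Type := Matrix.unitaryGroup (Fin N) ℂ

/-- The massless staggered Dirac operator in the defining representation of `U(N)`,
`D₀[U] = staggeredDirac unitaryFundamentalRep U 0`. [cite: SalmhoferSeiler1991, §2 (2.3)] -/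
abbrev D0 (U : GaugeConfig ν L (UN N)) : Matrix (CI ν L N) (CI ν L N) ℂ :=
  staggeredDirac (unitaryFundamentalRep (Fin N) ℂ) U 0

omit [NeZero L] in
/-- `D₀[U]` has the hopping shape with unit row weights and links `U`, `U⁻¹`. [cite: SalmhoferSeiler1991, §2 (2.3)] -/
theorem D0_eq_hopShape (U : GaugeConfig ν L (UN N)) :
    D0 U = hopShape (fun _ _ => (1 : ℂ)) (fun _ _ => (1 : ℂ))
      (fun e => ((U e : UN N) : Matrix (Fin N) (Fin N) ℂ)) (fun e => ((U e)⁻¹ : UN N)) := by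
  ext p q
  dsimp only [D0]
  rw [hopShape_apply, staggeredDirac, Matrix.of_apply]
  have h0 : (if p = q then ((0 : ℝ) : ℂ) else 0) = 0 := by split_ifs <;> simp
  rw [h0, zero_add, smul_eq_mul]
  congr 1
  refine Finset.sum_congr rfl fun μ _ => ?_
  rw [smul_eq_mul]
  congr 1
  simp only [one_mul, unitaryFundamentalRep_apply, QuantumFieldTheory.Site.shift, unitVec]

/-- The central element `e^{it}·1 ∈ U(N)`. [cite: SalmhoferSeiler1991, §2 (2.2)] -/
def phaseUnitary (N : ℕ) (t : ℝ) : UN N :=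
  ⟨Complex.exp (t * Complex.I) • (1 : Matrix (Fin N) (Fin N) ℂ), by
    rw [Matrix.mem_unitaryGroup_iff, star_smul, star_one, smul_mul_smul_comm, one_mul,
      Complex.star_def, Complex.mul_conj, Complex.normSq_eq_norm_sq, Complex.norm_exp_ofReal_mul_I]
    simp⟩

/-- The matrix of `phaseUnitary`. [cite: SalmhoferSeiler1991, §2 (2.2)] -/
theorem coe_phaseUnitary (t : ℝ) :
    ((phaseUnitary N t : UN N) : Matrix (Fin N) (Fin N) ℂ) = Complex.exp (t * Complex.I) • (1 : Matrix (Fin N) (Fin N) ℂ) := rfl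

/-- `t ↦ e^{it}·1` is continuous. [cite: SalmhoferSeiler1991, §2 (2.2)] -/
theorem continuous_phaseUnitary : Continuous (phaseUnitary N) := by
  refine Continuous.subtype_mk ?_ _
  exact (Complex.continuous_exp.comp (Complex.continuous_ofReal.mul continuous_const)).smul continuous_const

/-- The central rephasing of a gauge field: `(θ • U)_b = e^{iθ_b} U_b`. [cite: SalmhoferSeiler1991, §2 (2.12)] -/
def rephase (θ : TorusSite ν L × Fin ν → ℝ) (U : GaugeConfig ν L (UN N)) : GaugeConfig ν L (UN N) :=
  fun e => phaseUnitary N (θ e) * U e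

omit [NeZero L] in
/-- The rephased link matrix. [cite: SalmhoferSeiler1991, §2 (2.12)] -/
theorem coe_rephase (θ : TorusSite ν L × Fin ν → ℝ) (U : GaugeConfig ν L (UN N)) (e : TorusSite ν L × Fin ν) :
    ((rephase θ U e : UN N) : Matrix (Fin N) (Fin N) ℂ) = MvPolynomial.torusPt θ e • ((U e : UN N) : Matrix (Fin N) (Fin N) ℂ) := by
  show (((phaseUnitary N (θ e) * U e : UN N)) : Matrix (Fin N) (Fin N) ℂ) = _
  rw [Matrix.UnitaryGroup.mul_val, coe_phaseUnitary, smul_mul_assoc, one_mul, MvPolynomial.torusPt_apply]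

omit [NeZero L] in
/-- The inverse of the rephased link matrix. [cite: SalmhoferSeiler1991, §2 (2.12)] -/
theorem coe_rephase_inv (θ : TorusSite ν L × Fin ν → ℝ) (U : GaugeConfig ν L (UN N)) (e : TorusSite ν L × Fin ν) :
    (((rephase θ U e)⁻¹ : UN N) : Matrix (Fin N) (Fin N) ℂ) =
      Complex.exp (-(θ e * Complex.I)) • (((U e)⁻¹ : UN N) : Matrix (Fin N) (Fin N) ℂ) := by
  rw [Matrix.UnitaryGroup.inv_val, Matrix.UnitaryGroup.inv_val, coe_rephase, star_smul, MvPolynomial.torusPt_apply,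
    Complex.star_def, ← Complex.exp_conj, map_mul, Complex.conj_ofReal, Complex.conj_I, mul_neg]

omit [NeZero L] in
/-- `D₀` of the rephased field: hopping shape with row weights `e^{iθ_{(x,μ)}}`, `e^{-iθ_{(x-e_μ,μ)}}`. [cite: SalmhoferSeiler1991, §2 (2.3)] -/
theorem D0_rephase (θ : TorusSite ν L × Fin ν → ℝ) (U : GaugeConfig ν L (UN N)) :
    D0 (rephase θ U) = hopShape (fun x μ => MvPolynomial.torusPt θ (x, μ))
      (fun x μ => Complex.exp (-(θ (x - unitVec μ, μ) * Complex.I)))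
      (fun e => ((U e : UN N) : Matrix (Fin N) (Fin N) ℂ)) (fun e => ((U e)⁻¹ : UN N)) := by
  rw [D0_eq_hopShape]
  have hV : (fun e => ((rephase θ U e : UN N) : Matrix (Fin N) (Fin N) ℂ)) =
      fun e => MvPolynomial.torusPt θ e • ((U e : UN N) : Matrix (Fin N) (Fin N) ℂ) := funext (coe_rephase θ U)
  have hW : (fun e => (((rephase θ U e)⁻¹ : UN N) : Matrix (Fin N) (Fin N) ℂ)) =
      fun e => Complex.exp (-(θ e * Complex.I)) • (((U e)⁻¹ : UN N) : Matrix (Fin N) (Fin N) ℂ) := funext (coe_rephase_inv θ U)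
  rw [hV, hW, hopShape_smul_links]
  simp only [one_mul]

end Dirac

/-! ## 3. The polynomial `R_U` and its torus evaluation -/

section Poly

open MvPolynomial

/-- The variables of the links arriving at `x`: `s_x = ∏_μ z_{(x - e_μ, μ)}`. [cite: SalmhoferSeiler1991, §2 (2.3)] -/
def inMono (x : TorusSite ν L) : MvPolynomial (TorusSite ν L × Fin ν) ℂ := ∏ μ : Fin ν, X (x - unitVec μ, μ)

/-- The same product without the link of direction `μ`. [cite: SalmhoferSeiler1991, §2 (2.3)] -/
def inMonoErase (x : TorusSite ν L) (μ : Fin ν) : MvPolynomial (TorusSite ν L × Fin ν) ℂ :=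
  ∏ μ' ∈ Finset.univ.erase μ, X (x - unitVec μ', μ')

omit [NeZero L] in
/-- `s_x = (∏_{μ' ≠ μ} z_{(x-e_{μ'},μ')}) · z_{(x-e_μ,μ)}`. [cite: SalmhoferSeiler1991, §2 (2.3)] -/
theorem inMono_eq (x : TorusSite ν L) (μ : Fin ν) : inMono x = inMonoErase x μ * X (x - unitVec μ, μ) := by
  rw [inMono, inMonoErase, Finset.prod_erase_mul _ _ (Finset.mem_univ μ)]

/-- The polynomial link matrix: `D₀[zU]` with row `(x, a)` multiplied by `s_x`, as a matrix of
polynomials in the link variables `z`. [cite: SalmhoferSeiler1991, §2 (2.3)] -/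
def polyMatrix (U : GaugeConfig ν L (UN N)) :
    Matrix (CI ν L N) (CI ν L N) (MvPolynomial (TorusSite ν L × Fin ν) ℂ) :=
  hopShape (fun x μ => inMono x * X (x, μ)) (fun x μ => inMonoErase x μ)
    (fun e => ((U e : UN N) : Matrix (Fin N) (Fin N) ℂ).map (C : ℂ →+* _))
    (fun e => (((U e)⁻¹ : UN N) : Matrix (Fin N) (Fin N) ℂ).map (C : ℂ →+* _))

/-- **The polynomial `R_U = det` of the polynomial link matrix.** [cite: SalmhoferSeiler1991, §2 (2.11)] -/
def detPoly (U : GaugeConfig ν L (UN N)) : MvPolynomial (TorusSite ν L × Fin ν) ℂ := (polyMatrix U).det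

omit [NeZero L] in
/-- Evaluating a constant matrix of polynomials. [cite: SalmhoferSeiler1991, §2 (2.3)] -/
theorem aeval_mapMatrix_map_C (z : TorusSite ν L × Fin ν → ℂ) (M : Matrix (Fin N) (Fin N) ℂ) :
    (MvPolynomial.aeval z).mapMatrix (M.map (C : ℂ →+* MvPolynomial (TorusSite ν L × Fin ν) ℂ)) = M := by
  ext a b
  simp [AlgHom.mapMatrix_apply, Matrix.map_apply]

/-- Evaluation of the polynomial link matrix at a complex point `z`: hopping shape with row weights
`s_x(z) z_{(x,μ)}` and `∏_{μ'≠μ} z_{(x-e_{μ'},μ')}`. [cite: SalmhoferSeiler1991, §2 (2.3)] -/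
theorem aeval_polyMatrix (U : GaugeConfig ν L (UN N)) (z : TorusSite ν L × Fin ν → ℂ) :
    (MvPolynomial.aeval z).mapMatrix (polyMatrix U) =
      hopShape (fun x μ => (∏ μ', z (x - unitVec μ', μ')) * z (x, μ)) (fun x μ => ∏ μ' ∈ Finset.univ.erase μ, z (x - unitVec μ', μ'))
        (fun e => ((U e : UN N) : Matrix (Fin N) (Fin N) ℂ)) (fun e => ((U e)⁻¹ : UN N)) := by
  rw [polyMatrix, algHom_mapMatrix_hopShape]
  simp only [aeval_mapMatrix_map_C, map_mul, map_prod, inMono, inMonoErase, MvPolynomial.aeval_X]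

/-- **On the torus, `R_U(e^{iθ})` is a unit multiple of `det D₀[e^{iθ}U]`:**
`(∏_{rows (x,a)} s_x(e^{iθ})) · det D₀[θ • U] = R_U(e^{iθ})`. [cite: SalmhoferSeiler1991, §2 (2.11)] -/
theorem eval_torusPt_detPoly (U : GaugeConfig ν L (UN N)) (θ : TorusSite ν L × Fin ν → ℝ) :
    (∏ p : CI ν L N, ∏ μ', torusPt θ (p.1 - unitVec μ', μ')) * (D0 (rephase θ U)).det =
      MvPolynomial.eval (torusPt θ) (detPoly U) := by
  have h1 : MvPolynomial.eval (torusPt θ) (detPoly U) =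
      ((MvPolynomial.aeval (torusPt θ)).mapMatrix (polyMatrix U)).det := by
    rw [← MvPolynomial.coe_aeval_eq_eval, RingHom.coe_coe, detPoly, AlgHom.map_det]
  rw [h1, aeval_polyMatrix, D0_rephase, ← Matrix.det_diagonal, ← Matrix.det_mul,
    diagonal_mul_hopShape (fun x => ∏ μ', torusPt θ (x - unitVec μ', μ'))]
  congr 1
  congr 1
  funext x μ
  rw [← Finset.prod_erase_mul _ _ (Finset.mem_univ μ), mul_assoc, torusPt_apply, ← Complex.exp_add, add_neg_cancel,
    Complex.exp_zero, mul_one]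

end Poly

/-! ## 4. `R_U ≠ 0`: the forward hops of one direction dominate -/

section Nonzero

open MvPolynomial

variable [NeZero ν]

/-- The direction singled out (`0`). [cite: SalmhoferSeiler1991, §2 (2.1)] -/
abbrev dir0 (ν : ℕ) [NeZero ν] : Fin ν := 0

/-- The test point `z_t`: `t` on the links of direction `0`, `1` on the others. [cite: SalmhoferSeiler1991, §2 (2.3)] -/
def testPt (t : ℂ) : TorusSite ν L × Fin ν → ℂ := fun e => if e.2 = dir0 ν then t else 1

omit [NeZero L] in
/-- `s_x(z_t) = t`. [cite: SalmhoferSeiler1991, §2 (2.3)] -/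
theorem prod_testPt (t : ℂ) (x : TorusSite ν L) : ∏ μ', testPt (L := L) t (x - unitVec μ', μ') = t := by
  simp only [testPt]
  rw [Finset.prod_ite_eq']
  simp

omit [NeZero L] in
/-- `∏_{μ' ≠ μ} z_t(x - e_{μ'}, μ')` is `1` for `μ = 0` and `t` otherwise. [cite: SalmhoferSeiler1991, §2 (2.3)] -/
theorem prod_erase_testPt (t : ℂ) (x : TorusSite ν L) (μ : Fin ν) :
    ∏ μ' ∈ Finset.univ.erase μ, testPt (L := L) t (x - unitVec μ', μ') = if μ = dir0 ν then 1 else t := by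
  simp only [testPt]
  rw [Finset.prod_ite_eq']
  by_cases h : μ = dir0 ν
  · simp [h]
  · simp [h, Ne.symm h]

/-- The pencil `K_U(s) = F₀ + s M + s² B₀`: forward hops of direction `0` with weight `1`, the
other forward hops and the backward hops of the other directions with weight `s`, the backward
hops of direction `0` with weight `s²`. [cite: SalmhoferSeiler1991, §2 (2.3)] -/
def pencil (U : GaugeConfig ν L (UN N)) (s : ℂ) : Matrix (CI ν L N) (CI ν L N) ℂ :=
  hopShape (fun _ μ => if μ = dir0 ν then (1 : ℂ) else s) (fun _ μ => if μ = dir0 ν then s ^ 2 else s)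
    (fun e => ((U e : UN N) : Matrix (Fin N) (Fin N) ℂ)) (fun e => ((U e)⁻¹ : UN N))

/-- **`R_U(z_t) = det (t² K_U(t⁻¹))`** for `t ≠ 0`. [cite: SalmhoferSeiler1991, §2 (2.11)] -/
theorem aeval_testPt_polyMatrix (U : GaugeConfig ν L (UN N)) {t : ℂ} (ht : t ≠ 0) :
    (MvPolynomial.aeval (testPt (L := L) t)).mapMatrix (polyMatrix U) = (t ^ 2) • pencil U t⁻¹ := by
  rw [aeval_polyMatrix, pencil, smul_hopShape]
  congr 1
  · funext x μ
    rw [prod_testPt, testPt]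
    dsimp only
    split_ifs <;> field_simp
  · funext x μ
    rw [prod_erase_testPt]
    split_ifs <;> field_simp

/-- The forward hops of direction `0`: `(F₀)_{(x,a),(y,b)} = ½η₀(x) [y = x + e₀] U_{(x,0),ab}`. [cite: SalmhoferSeiler1991, §2 (2.3)] -/
def forwardHop (U : GaugeConfig ν L (UN N)) : Matrix (CI ν L N) (CI ν L N) ℂ :=
  Matrix.of fun p q => if q.1 = p.1 + unitVec (dir0 ν) then
    (1 / 2 : ℂ) * ((staggeredPhase p.1 (dir0 ν) : ℤ) : ℂ) * ((U (p.1, dir0 ν) : UN N) : Matrix (Fin N) (Fin N) ℂ) p.2 q.2 else 0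

omit [NeZero L] in
/-- `K_U(0) = F₀`. [cite: SalmhoferSeiler1991, §2 (2.3)] -/
theorem pencil_zero (U : GaugeConfig ν L (UN N)) : pencil U 0 = forwardHop U := by
  ext p q
  rw [pencil, hopShape_apply, forwardHop, Matrix.of_apply, Finset.sum_eq_single (dir0 ν)]
  · simp only [if_true, one_mul, ne_eq, OfNat.ofNat_ne_zero, not_false_eq_true, zero_pow, zero_mul, ite_self,
      sub_zero, smul_eq_mul]
    split_ifs <;> ring
  · intro μ _ hμ
    simp [hμ]
  · intro h; exact absurd (Finset.mem_univ _) h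

omit [NeZero L] in
/-- `s ↦ K_U(s)` is continuous. [cite: SalmhoferSeiler1991, §2 (2.3)] -/
theorem continuous_pencil (U : GaugeConfig ν L (UN N)) : Continuous (pencil U) := by
  have hw1 : ∀ μ : Fin ν, Continuous fun s : ℂ => (if μ = dir0 ν then (1 : ℂ) else s) := fun μ => by
    by_cases h : μ = dir0 ν
    · simp only [if_pos h]; exact continuous_const
    · simp only [if_neg h]; exact continuous_id
  have hw2 : ∀ μ : Fin ν, Continuous fun s : ℂ => (if μ = dir0 ν then s ^ 2 else s) := fun μ => by
    by_cases h : μ = dir0 ν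
    · simp only [if_pos h]; exact continuous_id.pow 2
    · simp only [if_neg h]; exact continuous_id
  refine continuous_pi fun p => continuous_pi fun q => ?_
  simp only [pencil, hopShape_apply]
  refine Continuous.smul (continuous_const : Continuous fun _ : ℂ => (1 / 2 : ℂ)) ?_
  refine continuous_finsetSum _ fun μ _ => ?_
  refine Continuous.smul (continuous_const : Continuous fun _ : ℂ => ((staggeredPhase p.1 μ : ℤ) : ℂ)) ?_
  refine Continuous.sub ?_ ?_
  · by_cases h : q.1 = p.1 + unitVec μ
    · simp only [if_pos h]; exact (hw1 μ).mul continuous_const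
    · simp only [if_neg h]; exact continuous_const
  · by_cases h : p.1 = q.1 + unitVec μ
    · simp only [if_pos h]; exact (hw2 μ).mul continuous_const
    · simp only [if_neg h]; exact continuous_const

/-- The site shift `(x, a) ↦ (x + e₀, a)` as a permutation of the colour indices. [cite: SalmhoferSeiler1991, §2 (2.1)] -/
def shiftPerm : Equiv.Perm (CI ν L N) :=
  ⟨fun p => (p.1 + unitVec (dir0 ν), p.2), fun p => (p.1 - unitVec (dir0 ν), p.2),
    fun p => by simp, fun p => by simp⟩

omit [NeZero L] in
/-- The inverse shift. [cite: SalmhoferSeiler1991, §2 (2.1)] -/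
theorem shiftPerm_symm_apply (q : CI ν L N) :
    (shiftPerm (ν := ν) (L := L) (N := N)).symm q = (q.1 - unitVec (dir0 ν), q.2) := rfl

/-- The block-diagonal factor `[x = y] ½η₀(x) U_{(x,0),ab}`. [cite: SalmhoferSeiler1991, §2 (2.3)] -/
def blockFactor (U : GaugeConfig ν L (UN N)) : Matrix (CI ν L N) (CI ν L N) ℂ :=
  Matrix.of fun p q => if p.1 = q.1 then
    (1 / 2 : ℂ) * ((staggeredPhase p.1 (dir0 ν) : ℤ) : ℂ) * ((U (p.1, dir0 ν) : UN N) : Matrix (Fin N) (Fin N) ℂ) p.2 q.2 else 0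

omit [NeZero L] in
/-- The block-diagonal factor is Mathlib's `blockDiagonal` up to swapping the index components. [cite: SalmhoferSeiler1991, §2 (2.3)] -/
theorem blockFactor_eq (U : GaugeConfig ν L (UN N)) :
    blockFactor U = Matrix.reindex (Equiv.prodComm _ _) (Equiv.prodComm _ _)
      (Matrix.blockDiagonal fun x : TorusSite ν L =>
        ((1 / 2 : ℂ) * ((staggeredPhase x (dir0 ν) : ℤ) : ℂ)) • ((U (x, dir0 ν) : UN N) : Matrix (Fin N) (Fin N) ℂ)) := by
  ext p q
  rw [blockFactor, Matrix.of_apply, Matrix.reindex_apply, Matrix.submatrix_apply, Equiv.prodComm_symm,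
    Equiv.prodComm_apply, Equiv.prodComm_apply, Matrix.blockDiagonal_apply]
  simp only [Prod.fst_swap, Prod.snd_swap, Matrix.smul_apply, smul_eq_mul]

/-- `det` of the block-diagonal factor. [cite: SalmhoferSeiler1991, §2 (2.11)] -/
theorem det_blockFactor (U : GaugeConfig ν L (UN N)) :
    (blockFactor U).det = ∏ x : TorusSite ν L,
      (((1 / 2 : ℂ) * ((staggeredPhase x (dir0 ν) : ℤ) : ℂ)) ^ N * ((U (x, dir0 ν) : UN N) : Matrix (Fin N) (Fin N) ℂ).det) := by
  rw [blockFactor_eq, Matrix.det_reindex_self, Matrix.det_blockDiagonal]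
  refine Finset.prod_congr rfl fun x _ => ?_
  rw [Matrix.det_smul, Fintype.card_fin]

omit [NeZero L] in
/-- `F₀ = (block-diagonal) with the columns permuted by the site shift`. [cite: SalmhoferSeiler1991, §2 (2.3)] -/
theorem forwardHop_eq (U : GaugeConfig ν L (UN N)) :
    forwardHop U = (blockFactor U).submatrix id (shiftPerm (ν := ν) (L := L) (N := N)).symm := by
  ext p q
  rw [Matrix.submatrix_apply, forwardHop, Matrix.of_apply, blockFactor, Matrix.of_apply, shiftPerm_symm_apply, id]
  by_cases h : q.1 = p.1 + unitVec (dir0 ν)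
  · rw [if_pos h, if_pos (by rw [h, add_sub_cancel_right])]
  · rw [if_neg h, if_neg]
    intro h'
    apply h
    rw [h', sub_add_cancel]

/-- A unitary matrix has nonzero determinant. [cite: SalmhoferSeiler1991, §2 (2.2)] -/
theorem det_coe_unitary_ne_zero (V : UN N) : ((V : UN N) : Matrix (Fin N) (Fin N) ℂ).det ≠ 0 := by
  have h := congrArg Matrix.det (Matrix.UnitaryGroup.star_mul_self V)
  rw [Matrix.det_mul, Matrix.det_one] at h
  intro h0
  rw [h0, mul_zero] at h
  exact zero_ne_one h

/-- **`det F₀ ≠ 0`** (`= ± 2^{-n} ∏_x η₀(x)^N det U_{(x,0)}`). [cite: SalmhoferSeiler1991, §2 (2.11)] -/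
theorem det_forwardHop_ne_zero (U : GaugeConfig ν L (UN N)) : (forwardHop U).det ≠ 0 := by
  rw [forwardHop_eq, Matrix.det_permute', det_blockFactor]
  refine mul_ne_zero ?_ (Finset.prod_ne_zero_iff.2 fun x _ => ?_)
  · exact_mod_cast Units.ne_zero (Equiv.Perm.sign _)
  · refine mul_ne_zero (pow_ne_zero _ (mul_ne_zero (by norm_num) ?_)) (det_coe_unitary_ne_zero _)
    exact_mod_cast Units.ne_zero (staggeredPhase x (dir0 ν))

/-- **`R_U ≠ 0`.** [cite: SalmhoferSeiler1991, §2 (2.11)] -/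
theorem detPoly_ne_zero (U : GaugeConfig ν L (UN N)) : detPoly U ≠ 0 := by
  -- `det K_U(s) → det F₀ ≠ 0` as `s → 0`, so `det K_U(s) ≠ 0` for some real `s > 0`
  have hcont : Continuous fun s => (pencil U s).det := (continuous_pencil U).matrix_det
  have h0 : (pencil U 0).det ≠ 0 := by rw [pencil_zero]; exact det_forwardHop_ne_zero U
  have hopen : IsOpen {s : ℂ | (pencil U s).det ≠ 0} := isOpen_ne_fun hcont continuous_const
  obtain ⟨ε, hε, hball⟩ := Metric.isOpen_iff.1 hopen 0 h0
  set s : ℂ := ((ε / 2 : ℝ) : ℂ) with hs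
  have hsmem : s ∈ Metric.ball (0 : ℂ) ε := by
    rw [Metric.mem_ball, dist_zero_right, hs, Complex.norm_real, Real.norm_eq_abs, abs_of_pos (by positivity)]
    linarith
  have hsne : s ≠ 0 := by
    rw [hs]; exact_mod_cast (by positivity : (ε / 2 : ℝ) ≠ 0)
  have hdet : (pencil U s).det ≠ 0 := hball hsmem
  -- evaluate `R_U` at `z_{1/s}`
  intro hR
  have heval : MvPolynomial.aeval (testPt (L := L) s⁻¹) (detPoly U) = 0 := by rw [hR, map_zero]
  rw [detPoly, AlgHom.map_det, aeval_testPt_polyMatrix U (inv_ne_zero hsne), inv_inv, Matrix.det_smul] at heval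
  exact mul_ne_zero (pow_ne_zero _ (pow_ne_zero _ (inv_ne_zero hsne))) hdet heval

end Nonzero

/-! ## 5. For every gauge field, almost every central rephasing gives an invertible `D₀` -/

section Torus

variable [NeZero ν]

/-- **For every `U`, `det D₀[θ • U] ≠ 0` for Lebesgue-almost every `θ`.** [cite: SalmhoferSeiler1991, §2 (2.11)] -/
theorem volume_setOf_det_D0_rephase_eq_zero (U : GaugeConfig ν L (UN N)) :
    volume {θ : TorusSite ν L × Fin ν → ℝ | (D0 (rephase θ U)).det = 0} = 0 :=
  MvPolynomial.volume_setOf_eq_zero_of_mul_eq_eval_torusPt (detPoly U) (detPoly_ne_zero U)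
    (fun θ => eval_torusPt_detPoly U θ)

end Torus

/-! ## 6. Random central rephasing: Haar-nullity -/

section Haar

/-- The product Haar probability measure `∏_b dU_b` on `U(N)^{edges}` (the tree's `wilsonWeight ρ 0`,
Salmhofer–Seiler's `𝒟_Λ U` (2.12)). [cite: SalmhoferSeiler1991, §2 (2.12)] -/
abbrev linkHaar (ν L N : ℕ) [NeZero L] : Measure (GaugeConfig ν L (UN N)) :=
  Measure.pi fun _ : TorusSite ν L × Fin ν => haarProbability (UN N)

/-- The uniform probability measure on the box of angles `[0,1]^{edges}`. [cite: SalmhoferSeiler1991, §2 (2.12)] -/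
def angleBox (ν L : ℕ) [NeZero L] : Measure (TorusSite ν L × Fin ν → ℝ) :=
  (volume : Measure (TorusSite ν L × Fin ν → ℝ)).restrict (Set.univ.pi fun _ => Set.Icc (0 : ℝ) 1)

/-- The box has total mass one. [cite: SalmhoferSeiler1991, §2 (2.12)] -/
theorem isProbabilityMeasure_angleBox : IsProbabilityMeasure (angleBox ν L) := by
  constructor
  rw [angleBox, Measure.restrict_apply_univ, volume_pi, Measure.pi_pi]
  simp [Real.volume_Icc]

/-- Lebesgue-null sets of angles are null for the box. [cite: SalmhoferSeiler1991, §2 (2.12)] -/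
theorem angleBox_absolutelyContinuous : angleBox ν L ≪ volume :=
  Measure.absolutelyContinuous_of_le Measure.restrict_le_self

/-- Rephasing as a map of the pair (angles, gauge field). [cite: SalmhoferSeiler1991, §2 (2.12)] -/
def rephasePair (p : (TorusSite ν L × Fin ν → ℝ) × GaugeConfig ν L (UN N)) : GaugeConfig ν L (UN N) :=
  rephase p.1 p.2

omit [NeZero L] in
/-- Joint measurability of the rephasing. [cite: SalmhoferSeiler1991, §2 (2.12)] -/
theorem measurable_rephasePair : Measurable (rephasePair (ν := ν) (L := L) (N := N)) := by
  haveI : SecondCountableTopology (UN N) := by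
    haveI : SecondCountableTopology (Matrix (Fin N) (Fin N) ℂ) :=
      inferInstanceAs (SecondCountableTopology (Fin N → Fin N → ℂ))
    exact TopologicalSpace.Subtype.secondCountableTopology _
  refine measurable_pi_iff.2 fun e => ?_
  have h1 : Measurable fun p : (TorusSite ν L × Fin ν → ℝ) × GaugeConfig ν L (UN N) => phaseUnitary N (p.1 e) :=
    continuous_phaseUnitary.measurable.comp ((measurable_pi_apply e).comp measurable_fst)
  have h2 : Measurable fun p : (TorusSite ν L × Fin ν → ℝ) × GaugeConfig ν L (UN N) => p.2 e :=
    (measurable_pi_apply e).comp measurable_snd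
  exact h1.mul h2

/-- **Each fixed rephasing preserves the product Haar measure** (left multiplication linkwise). [cite: SalmhoferSeiler1991, §2 (2.12)] -/
theorem measurePreserving_rephase (θ : TorusSite ν L × Fin ν → ℝ) :
    MeasurePreserving (rephase (N := N) θ) (linkHaar ν L N) (linkHaar ν L N) := by
  haveI : Measure.IsHaarMeasure (haarProbability (UN N)) := by unfold haarProbability; infer_instance
  exact measurePreserving_pi (fun _ : TorusSite ν L × Fin ν => haarProbability (UN N))
    (fun _ => haarProbability (UN N)) fun e => measurePreserving_mul_left (haarProbability (UN N)) (phaseUnitary N (θ e))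

/-- **Random rephasing lemma**: a measurable set of gauge fields which almost no central rephasing
of ANY gauge field enters is null for the product Haar measure (Tonelli both ways for the
measure-preserving family `U ↦ θ • U`). [cite: SalmhoferSeiler1991, §2 (2.12)] -/
theorem linkHaar_eq_zero_of_rephase {Z : Set (GaugeConfig ν L (UN N))} (hZ : MeasurableSet Z)
    (h : ∀ U, angleBox ν L {θ | rephase θ U ∈ Z} = 0) : linkHaar ν L N Z = 0 := by
  haveI := isProbabilityMeasure_angleBox (ν := ν) (L := L)
  set lam := angleBox ν L
  set μ := linkHaar ν L N
  have hS : MeasurableSet (rephasePair ⁻¹' Z : Set ((TorusSite ν L × Fin ν → ℝ) × GaugeConfig ν L (UN N))) :=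
    measurable_rephasePair hZ
  -- integrate over `U` first: every section is `λ`-null
  have h1 : (lam.prod μ) (rephasePair ⁻¹' Z) = 0 := by
    rw [Measure.prod_apply_symm hS]
    have : (fun U : GaugeConfig ν L (UN N) => lam ((fun θ => (θ, U)) ⁻¹' (rephasePair ⁻¹' Z))) = fun _ => 0 := by
      funext U; exact h U
    rw [this, lintegral_zero]
  -- integrate over `θ` first: every section has measure `μ Z`
  have h2 : (lam.prod μ) (rephasePair ⁻¹' Z) = μ Z := by
    rw [Measure.prod_apply hS]
    have : (fun θ : TorusSite ν L × Fin ν → ℝ => μ (Prod.mk θ ⁻¹' (rephasePair ⁻¹' Z))) = fun _ => μ Z := by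
      funext θ
      exact (measurePreserving_rephase (N := N) θ).measure_preimage hZ.nullMeasurableSet
    rw [this, lintegral_const, measure_univ, mul_one]
  rw [← h2, h1]

omit [NeZero L] in
/-- `U ↦ D₀[U]` is continuous. [cite: SalmhoferSeiler1991, §2 (2.3)] -/
theorem continuous_D0 : Continuous (D0 (ν := ν) (L := L) (N := N)) := by
  have hc : ∀ (e : TorusSite ν L × Fin ν) (a b : Fin N),
      Continuous fun U : GaugeConfig ν L (UN N) => ((U e : UN N) : Matrix (Fin N) (Fin N) ℂ) a b := fun e a b =>
    (continuous_subtype_val.comp (continuous_apply e)).matrix_elem a b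
  have hci : ∀ (e : TorusSite ν L × Fin ν) (a b : Fin N),
      Continuous fun U : GaugeConfig ν L (UN N) => (((U e)⁻¹ : UN N) : Matrix (Fin N) (Fin N) ℂ) a b := fun e a b =>
    (continuous_subtype_val.comp ((continuous_apply e).inv)).matrix_elem a b
  refine continuous_pi fun p => continuous_pi fun q => ?_
  simp only [D0_eq_hopShape, hopShape_apply, one_mul]
  refine Continuous.smul (continuous_const : Continuous fun _ : GaugeConfig ν L (UN N) => (1 / 2 : ℂ)) ?_
  refine continuous_finsetSum _ fun μ _ => ?_
  refine Continuous.smul (continuous_const : Continuous fun _ : GaugeConfig ν L (UN N) => ((staggeredPhase p.1 μ : ℤ) : ℂ)) ?_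
  refine Continuous.sub ?_ ?_
  · by_cases h : q.1 = p.1 + unitVec μ
    · simp only [if_pos h]; exact hc _ _ _
    · simp only [if_neg h]; exact continuous_const
  · by_cases h : p.1 = q.1 + unitVec μ
    · simp only [if_pos h]; exact hci _ _ _
    · simp only [if_neg h]; exact continuous_const

/-- The singular set `{U : det D₀[U] = 0}` is closed, hence measurable. [cite: SalmhoferSeiler1991, §2 (2.11)] -/
theorem measurableSet_setOf_det_D0_eq_zero :
    MeasurableSet {U : GaugeConfig ν L (UN N) | (D0 U).det = 0} := by
  haveI : SecondCountableTopology (UN N) := by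
    haveI : SecondCountableTopology (Matrix (Fin N) (Fin N) ℂ) :=
      inferInstanceAs (SecondCountableTopology (Fin N → Fin N → ℂ))
    exact TopologicalSpace.Subtype.secondCountableTopology _
  exact (isClosed_eq continuous_D0.matrix_det continuous_const).measurableSet

variable [NeZero ν]

/-- **The massless staggered Dirac operator is singular only on a Haar-null set of gauge fields**:
`(∏_b dU_b) {U ∈ U(N)^{edges} : det D₀[U] = 0} = 0` (`ν ≥ 1`, any `L ≥ 1`, `N`). [cite: SalmhoferSeiler1991, §2 (2.11)–(2.12)] -/
theorem measure_pi_setOf_det_staggeredDirac_eq_zero :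
    (Measure.pi fun _ : TorusSite ν L × Fin ν => haarProbability (Matrix.unitaryGroup (Fin N) ℂ))
      {U : GaugeConfig ν L (Matrix.unitaryGroup (Fin N) ℂ) | (staggeredDirac (unitaryFundamentalRep (Fin N) ℂ) U 0).det = 0} = 0 :=
  linkHaar_eq_zero_of_rephase measurableSet_setOf_det_D0_eq_zero fun U =>
    angleBox_absolutelyContinuous (volume_setOf_det_D0_rephase_eq_zero U)

/-- **Almost-everywhere form**: `det D₀[U] ≠ 0` for `∏_b dU_b`-almost every `U`. [cite: SalmhoferSeiler1991, §2 (2.11)–(2.12)] -/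
theorem ae_det_staggeredDirac_ne_zero :
    ∀ᵐ U ∂(Measure.pi fun _ : TorusSite ν L × Fin ν => haarProbability (Matrix.unitaryGroup (Fin N) ℂ)),
      (staggeredDirac (unitaryFundamentalRep (Fin N) ℂ) U 0).det ≠ 0 := by
  rw [ae_iff]
  simpa using measure_pi_setOf_det_staggeredDirac_eq_zero (ν := ν) (L := L) (N := N)

end Haar

end StaggeredSingular

end Literature.MathematicalPhysics.QuantumLattice

end
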